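import Summits.QuantumFields.GaugeBoot.BootstrapConvergence
import Summits.QuantumFields.GaugeBoot.AbelianBootstrapFunctionals
import HarnessLib

/-!
# Convergence of truncated bootstraps with a restricted class of test functions; the abelian Wilson-loop bootstrap converges (gauge-boot, L1 supplement)

HONEST FRAMING (cell `pub-gaugeboot`, page 1 of every file): the venture produces certified bounds
on lattice expectations at stated coupling, gauge group, dimension and torus size; NOT a mass gap,
NOT a continuum limit, NOT a string tension; NOT Yang–Mills-summit-bearing (barriers
`FixedCouplingUltralocality`, `PerturbativeInvisibility`). Structural; it certifies no number
and says nothing about RATES of convergence.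

## Content

`BootstrapConvergence.lean` imposes, in the limit, the loop equations for ALL polynomial test
functions. A Wilson-loop bootstrap imposes them only for test functions in a class `Q` (gauge
invariance). The compactness argument is verbatim the same:

* `IsBootstrapFeasibleOn Q … V φ` — normalisation, square-positivity on `V`, loop equations for the
  test functions `f ∈ V` with `Q f`; `isBootstrapFeasibleOn_poly_iff` (untruncated = (N)+(P)+
  `IsSDFunctionalOn Q`), `IsBootstrapFeasible.feasibleOn` (fewer rows, more feasible functionals);
* ★★ `bootstrap_convergence_on` — any truncation scheme eventually containing each polynomial: the
  level-`n` feasible values of a polynomial observable are eventually all within `ε` of the value of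
  an untruncated `Q`-solution;
* ★★★ `abelianBootstrap_convergence_u1` — `U(1)` on the torus `(ℤ/L)^d`, ANY real `β`, loop
  equations only for GAUGE-INVARIANT polynomial test functions (Wilson loops), positivity on the
  level-`n` polynomials: for every gauge-invariant polynomial observable `P` and `ε > 0`, at some level
  every feasible value of `P` is within `ε` of its Wilson expectation (`eq_wilson_of_abelianBootstrap_u1`).

References: Z. Li, S. Zhou, arXiv:2404.17071 (the abelian Wilson-loop bootstrap, numerically);
P. Anderson, M. Kruczenski, Nucl. Phys. B 921 (2017); V. Kazakov, Z. Zheng, arXiv:2203.11360.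
Folklore.
-/

noncomputable section

open MeasureTheory Filter Topology NormedSpace
open Literature.MathematicalPhysics.QuantumFieldTheory (haarProbability LatticeRep)

namespace Summit.QuantumFields.GaugeBoot

section General

variable {ι : Type*} [DecidableEq ι] [Countable ι] {G : Type*} [Group G] [TopologicalSpace G]
  [IsTopologicalGroup G] [CompactSpace G] [MeasurableSpace G] [BorelSpace G]
  [SecondCountableTopology G] (r : LatticeRep G) {K : Type*}

/-- **Truncated bootstrap feasibility with test-function class `Q`**: `φ 1 = 1`, `0 ≤ φ (v v)` for
`v ∈ V`, and the loop equations `φ f' = β φ (f S_i')` for the test functions `f ∈ V` satisfying `Q`.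
[shape] A parametric definition of a proposition — NOT a fact. [folklore] -/
def IsBootstrapFeasibleOn (Q : ((ι → G) → ℝ) → Prop) (k : K → ℝ → G) (S : ι → (ι → G) → ℝ) (β : ℝ)
    (V : Set C(ι → G, ℝ)) (φ : C(ι → G, ℝ) →ₗ[ℝ] ℝ) : Prop :=
  φ 1 = 1 ∧ (∀ v ∈ V, 0 ≤ φ (v * v)) ∧
    ∀ (i : ι) (a : K), ∃ S' ∈ polyAlgebra (ι := ι) r,
      (∀ U, HasDerivAt (fun t => S i (Function.update U i (k a t * U i))) (S' U) 0) ∧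
        ∀ f ∈ V, Q f → ∀ f' ∈ polyAlgebra (ι := ι) r,
          (∀ U, HasDerivAt (fun t => f (Function.update U i (k a t * U i))) (f' U) 0) →
            φ f' = β * φ (f * S')

variable {k : K → ℝ → G} {X : K → Matrix (Fin r.N) (Fin r.N) ℂ} {S : ι → (ι → G) → ℝ} {β : ℝ}

omit [Countable ι] [IsTopologicalGroup G] [CompactSpace G] [MeasurableSpace G] [BorelSpace G]
  [SecondCountableTopology G] in
/-- The untruncated `Q`-bootstrap is (N)+(P)+`IsSDFunctionalOn Q`. -/
theorem isBootstrapFeasibleOn_poly_iff {Q : ((ι → G) → ℝ) → Prop} {φ : C(ι → G, ℝ) →ₗ[ℝ] ℝ} :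
    IsBootstrapFeasibleOn r Q k S β (polyAlgebra (ι := ι) r : Set C(ι → G, ℝ)) φ ↔
      φ 1 = 1 ∧ (∀ a ∈ polyAlgebra (ι := ι) r, 0 ≤ φ (a * a)) ∧ IsSDFunctionalOn r Q k S β φ :=
  Iff.rfl

omit [Countable ι] [IsTopologicalGroup G] [CompactSpace G] [MeasurableSpace G] [BorelSpace G]
  [SecondCountableTopology G] in
/-- Fewer rows: feasibility for all test functions implies feasibility for the class `Q`. -/
theorem IsBootstrapFeasible.feasibleOn {V : Set C(ι → G, ℝ)} {φ : C(ι → G, ℝ) →ₗ[ℝ] ℝ}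
    (h : IsBootstrapFeasible r k S β V φ) (Q : ((ι → G) → ℝ) → Prop) :
    IsBootstrapFeasibleOn r Q k S β V φ := by
  refine ⟨h.1, h.2.1, fun i a => ?_⟩
  obtain ⟨S', hS'm, hS', hrows⟩ := h.2.2 i a
  exact ⟨S', hS'm, hS', fun f hf _ => hrows f hf⟩

omit [Countable ι] [IsTopologicalGroup G] [CompactSpace G] [MeasurableSpace G] [BorelSpace G]
  [SecondCountableTopology G] in
/-- Antitone in the test-function set. -/
theorem IsBootstrapFeasibleOn.mono {Q : ((ι → G) → ℝ) → Prop} {V W : Set C(ι → G, ℝ)} (hVW : V ⊆ W)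
    {φ : C(ι → G, ℝ) →ₗ[ℝ] ℝ} (h : IsBootstrapFeasibleOn r Q k S β W φ) :
    IsBootstrapFeasibleOn r Q k S β V φ := by
  refine ⟨h.1, fun v hv => h.2.1 v (hVW hv), fun i a => ?_⟩
  obtain ⟨S', hS'm, hS', hrows⟩ := h.2.2 i a
  exact ⟨S', hS'm, hS', fun f hf => hrows f (hVW hf)⟩

omit [Countable ι] [CompactSpace G] [MeasurableSpace G] [BorelSpace G] [SecondCountableTopology G] in
/-- ★★ **Convergence of truncated `Q`-bootstraps** (the compactness argument of
`bootstrap_convergence`, with the rows carried only for the class `Q`). [folklore] -/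
theorem bootstrap_convergence_on (Q : ((ι → G) → ℝ) → Prop)
    (hk : ∀ a s t, k a (s + t) = k a s * k a t)
    (hX : ∀ a t, r.ρ (k a t) = exp ((t : ℂ) • X a)) (hS : ∀ i, S i ∈ polyFunctions (ι := ι) r)
    (V : ℕ → Set C(ι → G, ℝ)) (hex : ∀ a ∈ polyAlgebra (ι := ι) r, ∀ᶠ n in atTop, a ∈ V n)
    {P : C(ι → G, ℝ)} (hP : P ∈ polyAlgebra (ι := ι) r) {ε : ℝ} (hε : 0 < ε) :
    ∃ n, ∀ φ : C(ι → G, ℝ) →ₗ[ℝ] ℝ, IsBootstrapFeasibleOn r Q k S β (V n) φ →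
      ∃ ψ : C(ι → G, ℝ) →ₗ[ℝ] ℝ,
        IsBootstrapFeasibleOn r Q k S β (polyAlgebra (ι := ι) r : Set C(ι → G, ℝ)) ψ ∧ |φ P - ψ P| ≤ ε := by
  classical
  by_contra hcon
  push Not at hcon
  choose φ hφ hfar using hcon
  -- the polynomial derivatives of the local actions
  have hS'ex : ∀ (i : ι) (a : K), ∃ S' ∈ polyAlgebra (ι := ι) r,
      ∀ U, HasDerivAt (fun t => S i (Function.update U i (k a t * U i))) (S' U) 0 := fun i a => by
    obtain ⟨S₀, hS₀, hS₀e⟩ := (mem_polyFunctions_iff r).1 (hS i)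
    obtain ⟨S', hS'm, hS'⟩ := exists_deriv_mem_polyAlgebra r (hk a) (hX a) i hS₀
    exact ⟨S', hS'm, by rw [← hS₀e]; exact hS'⟩
  choose S' hS'm hS'd using hS'ex
  -- archimedean bounds: each polynomial is bounded by finitely many PSD constraints
  have hb : ∀ a : C(ι → G, ℝ), ∃ (C : ℝ) (s : Finset C(ι → G, ℝ)), a ∈ polyAlgebra (ι := ι) r →
      (∀ v ∈ s, v ∈ polyAlgebra (ι := ι) r) ∧ ∀ φ : C(ι → G, ℝ) →ₗ[ℝ] ℝ, φ 1 = 1 →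
        (∀ v ∈ s, 0 ≤ φ (v * v)) → |φ a| ≤ C := fun a => by
    by_cases ha : a ∈ polyAlgebra (ι := ι) r
    · obtain ⟨C, s, h1, h2⟩ := exists_finset_abs_le r ha
      exact ⟨C, s, fun _ => ⟨h1, h2⟩⟩
    · exact ⟨0, ∅, fun h => (ha h).elim⟩
  choose C s hCs using hb
  -- the truncated sequence of putative solutions, as points of the product space
  let good : ℕ → C(ι → G, ℝ) → Prop := fun n a => a ∈ polyAlgebra (ι := ι) r ∧ ∀ v ∈ s a, v ∈ V n
  let Φ : ℕ → (C(ι → G, ℝ) → ℝ) := fun n a => if good n a then φ n a else 0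
  have hgood : ∀ a ∈ polyAlgebra (ι := ι) r, ∀ᶠ n in atTop, good n a := fun a ha => by
    have h : ∀ᶠ n in atTop, ∀ v ∈ s a, v ∈ V n :=
      (Filter.eventually_all_finset (s a)).2 fun v hv => hex v ((hCs a ha).1 v hv)
    exact h.mono fun n hn => ⟨ha, hn⟩
  have hΦeq : ∀ a ∈ polyAlgebra (ι := ι) r, ∀ᶠ n in atTop, Φ n a = φ n a := fun a ha =>
    (hgood a ha).mono fun n hn => if_pos hn
  -- it lives in a compact box (Tychonoff)
  set B : Set (C(ι → G, ℝ) → ℝ) := Set.univ.pi fun a => Set.Icc (-|C a|) |C a| with hB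
  have hBc : IsCompact B := isCompact_univ_pi fun a => isCompact_Icc
  have hΦB : ∀ n, Φ n ∈ B := fun n => Set.mem_univ_pi.2 fun a => by
    by_cases hg : good n a
    · have h := (hCs a hg.1).2 (φ n) (hφ n).1 fun v hv => (hφ n).2.1 v (hg.2 v hv)
      have h' : |Φ n a| ≤ |C a| := by
        simp only [Φ, if_pos hg]
        exact h.trans (le_abs_self _)
      exact ⟨(abs_le.1 h').1, (abs_le.1 h').2⟩
    · simp only [Φ, if_neg hg, Set.mem_Icc, Left.neg_nonpos_iff, abs_nonneg, and_self]
  -- a cluster point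
  obtain ⟨x, -, hx⟩ := hBc.exists_clusterPt (f := map Φ atTop)
    (le_principal_iff.2 (mem_map.2 (Eventually.of_forall hΦB)))
  have key : ∀ {T : Set (C(ι → G, ℝ) → ℝ)}, IsClosed T → (∀ᶠ n in atTop, Φ n ∈ T) → x ∈ T :=
    fun hT hev => mem_of_clusterPt_map hx hT hev
  -- the cluster point solves every untruncated constraint
  have hx1 : x 1 = 1 := by
    refine key (T := {y | y 1 = 1}) (isClosed_eq (continuous_apply _) continuous_const) ?_
    filter_upwards [hΦeq 1 (polyAlgebra (ι := ι) r).one_mem] with n h1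
    simp only [h1]
    exact (hφ n).1
  have hxadd : ∀ a ∈ polyAlgebra (ι := ι) r, ∀ b ∈ polyAlgebra (ι := ι) r,
      x (a + b) = x a + x b := fun a ha b hb => by
    refine key (T := {y | y (a + b) = y a + y b})
      (isClosed_eq (continuous_apply _) ((continuous_apply a).add (continuous_apply b))) ?_
    filter_upwards [hΦeq a ha, hΦeq b hb, hΦeq (a + b) ((polyAlgebra (ι := ι) r).add_mem ha hb)]
      with n h1 h2 h3
    simp only [h1, h2, h3, map_add]
  have hxsmul : ∀ (c : ℝ), ∀ a ∈ polyAlgebra (ι := ι) r, x (c • a) = c * x a := fun c a ha => by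
    refine key (T := {y | y (c • a) = c * y a})
      (isClosed_eq (continuous_apply _) (continuous_const.mul (continuous_apply a))) ?_
    filter_upwards [hΦeq a ha, hΦeq (c • a) ((polyAlgebra (ι := ι) r).smul_mem ha c)] with n h1 h2
    simp only [h1, h2, map_smul, smul_eq_mul]
  have hxpos : ∀ v ∈ polyAlgebra (ι := ι) r, 0 ≤ x (v * v) := fun v hv => by
    refine key (T := {y | 0 ≤ y (v * v)}) (isClosed_le continuous_const (continuous_apply _)) ?_
    filter_upwards [hΦeq (v * v) ((polyAlgebra (ι := ι) r).mul_mem hv hv), hex v hv] with n h1 h2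
    simp only [h1]
    exact (hφ n).2.1 v h2
  have hxsd : ∀ (i : ι) (a : K), ∀ f ∈ polyAlgebra (ι := ι) r, Q f → ∀ f' ∈ polyAlgebra (ι := ι) r,
      (∀ U, HasDerivAt (fun t => f (Function.update U i (k a t * U i))) (f' U) 0) →
        x f' = β * x (f * S' i a) := fun i a f hf hQ f' hf' hd => by
    refine key (T := {y | y f' = β * y (f * S' i a)})
      (isClosed_eq (continuous_apply _) (continuous_const.mul (continuous_apply _))) ?_
    filter_upwards [hΦeq f' hf', hΦeq (f * S' i a) ((polyAlgebra (ι := ι) r).mul_mem hf (hS'm i a)),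
      hex f hf] with n h1 h2 h3
    simp only [h1, h2]
    obtain ⟨S'', -, hS''d, hrows⟩ := (hφ n).2.2 i a
    have he : S'' = S' i a := ContinuousMap.ext fun U => (hS''d U).unique (hS'd i a U)
    rw [← he]
    exact hrows f h3 hQ f' hf' hd
  have hxfar : ∀ ψ : C(ι → G, ℝ) →ₗ[ℝ] ℝ,
      IsBootstrapFeasibleOn r Q k S β (polyAlgebra (ι := ι) r : Set C(ι → G, ℝ)) ψ → ε ≤ |x P - ψ P| :=
    fun ψ hψ => by
    refine key (T := {y | ε ≤ |y P - ψ P|})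
      (isClosed_le continuous_const ((continuous_apply P).sub continuous_const).abs) ?_
    filter_upwards [hΦeq P hP] with n h1
    simp only [h1]
    exact (hfar n ψ hψ).le
  -- the cluster point IS an untruncated solution: contradiction
  let ψ₀ : Subalgebra.toSubmodule (polyAlgebra (ι := ι) r) →ₗ[ℝ] ℝ :=
    { toFun := fun a => x a
      map_add' := fun a b => hxadd a a.2 b b.2
      map_smul' := fun c a => by simpa using hxsmul c a a.2 }
  obtain ⟨ψ, hψ⟩ := LinearMap.exists_extend ψ₀
  have hψa : ∀ a ∈ polyAlgebra (ι := ι) r, ψ a = x a := fun a ha => by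
    have h := LinearMap.congr_fun hψ ⟨a, ha⟩
    simpa [ψ₀] using h
  have hψfeas : IsBootstrapFeasibleOn r Q k S β (polyAlgebra (ι := ι) r : Set C(ι → G, ℝ)) ψ := by
    refine ⟨by rw [hψa 1 (polyAlgebra (ι := ι) r).one_mem, hx1], fun v hv => ?_, fun i a => ?_⟩
    · rw [hψa _ ((polyAlgebra (ι := ι) r).mul_mem hv hv)]
      exact hxpos v hv
    · refine ⟨S' i a, hS'm i a, hS'd i a, fun f hf hQ f' hf' hd => ?_⟩
      rw [hψa f' hf', hψa _ ((polyAlgebra (ι := ι) r).mul_mem hf (hS'm i a))]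
      exact hxsd i a f hf hQ f' hf' hd
  have h := hxfar ψ hψfeas
  rw [hψa P hP, sub_self, abs_zero] at h
  exact absurd h (not_le.2 hε)


end General

/-! ## `U(1)`: the truncated Wilson-loop bootstrap converges -/

section Abelian

open Literature.MathematicalPhysics.QuantumFieldTheory (Site Edge GaugeConfig gaugeTransform
  IsGaugeInvariant wilsonAction wilsonMeasure)
open Literature.MathematicalPhysics.QuantumLattice

variable {d L : ℕ}

/-- ★★★ **Convergence of the truncated abelian Wilson-loop bootstrap.** `U(1)` on the torus
`(ℤ/L)^d`, ANY real `β`, any truncation scheme `V n` eventually containing each polynomial observable,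
loop equations imposed only for the GAUGE-INVARIANT test functions of `V n`: for every gauge-invariant
polynomial observable `P` and `ε > 0` there is a level at which every feasible value of `P` is within
`ε` of its Wilson expectation. [folklore] -/
theorem abelianBootstrap_convergence_u1 [NeZero L] (β : ℝ)
    (V : ℕ → Set C(GaugeConfig d L (Matrix.unitaryGroup (Fin 1) ℂ), ℝ))
    (hex : ∀ a ∈ polyAlgebra (ι := Edge d L) (unitaryFundamentalLatticeRep 1), ∀ᶠ n in atTop, a ∈ V n)
    {P : C(GaugeConfig d L (Matrix.unitaryGroup (Fin 1) ℂ), ℝ)}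
    (hP : P ∈ polyAlgebra (ι := Edge d L) (unitaryFundamentalLatticeRep 1))
    (hPi : IsGaugeInvariant (⇑P)) {ε : ℝ} (hε : 0 < ε) :
    ∃ n, ∀ φ : C(GaugeConfig d L (Matrix.unitaryGroup (Fin 1) ℂ), ℝ) →ₗ[ℝ] ℝ,
      IsBootstrapFeasibleOn (unitaryFundamentalLatticeRep 1) IsGaugeInvariant (uExp 1)
          (fun _ => wilsonAction (unitaryFundamentalRep (Fin 1) ℂ)) β (V n) φ →
        |φ P - ∫ U, P U ∂(wilsonMeasure (unitaryFundamentalRep (Fin 1) ℂ) β)| ≤ ε := by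
  obtain ⟨n, hn⟩ := bootstrap_convergence_on (unitaryFundamentalLatticeRep 1) IsGaugeInvariant
    (uExp_add 1) (X := fun X : UGenerator 1 => (X : Matrix (Fin 1) (Fin 1) ℂ)) (rho_uExp 1)
    (fun _ => wilsonAction_mem_polyFunctions (unitaryFundamentalLatticeRep 1)) V hex hP hε
  refine ⟨n, fun φ hφ => ?_⟩
  obtain ⟨ψ, hψ, hclose⟩ := hn φ hφ
  rwa [eq_wilson_of_abelianBootstrap_u1 β hψ.1 hψ.2.1 hψ.2.2 hP hPi] at hclose

/-- **The Wilson expectation is feasible for the Wilson-loop bootstrap at every polynomial level.**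
[folklore] -/
theorem isBootstrapFeasibleOn_wilson_u1 [NeZero L] (β : ℝ)
    (μ : Measure (GaugeConfig d L (Matrix.unitaryGroup (Fin 1) ℂ))) [IsProbabilityMeasure μ]
    (hμ : μ = wilsonMeasure (unitaryFundamentalRep (Fin 1) ℂ) β)
    {V : Set C(GaugeConfig d L (Matrix.unitaryGroup (Fin 1) ℂ), ℝ)}
    (hV : V ⊆ polyAlgebra (ι := Edge d L) (unitaryFundamentalLatticeRep 1)) :
    IsBootstrapFeasibleOn (unitaryFundamentalLatticeRep 1) IsGaugeInvariant (uExp 1)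
      (fun _ => wilsonAction (unitaryFundamentalRep (Fin 1) ℂ)) β V (expectationFunctional μ) :=
  ((isBootstrapFeasible_poly_iff (unitaryFundamentalLatticeRep 1)).2
    ⟨expectationFunctional_one μ, fun v _ => expectationFunctional_sq_nonneg μ v,
      isSDFunctional_expectationFunctional (unitaryFundamentalLatticeRep 1) (uExp_add 1)
        (X := fun X : UGenerator 1 => (X : Matrix (Fin 1) (Fin 1) ℂ)) (rho_uExp 1)
        (fun _ => wilsonAction_mem_polyFunctions (unitaryFundamentalLatticeRep 1)) μ
        ((eq_wilsonMeasure_iff_polySD_uN 1 β μ).1 hμ)⟩).feasibleOn (unitaryFundamentalLatticeRep 1)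
      IsGaugeInvariant |>.mono (unitaryFundamentalLatticeRep 1) hV

end Abelian

end Summit.QuantumFields.GaugeBoot

end
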